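import Literature.IUT.HodgeTheaters.BadLocalFrobenioidOfKitsDdash
import Literature.IUT.HodgeTheaters.BadLocalFrobenioidOfKitsTemperedBases
import Literature.AnabelianGeometry.SemiGraphs.OneVertexCuspsRestrict
import HarnessLib

/-!
# [IUTchI] Example 3.2 (iii) `CFromF` and (vi) (d) `DFromF` AT THE GENUINE BAD DATUM over an [EtTh] Def. 3.6 tempered
# Frobenioid on the GENUINE base: `badLocalFrobenioidAt … R.toInput` and the double-underline group datum

S. Mochizuki, *Inter-universal Teichmüller theory I*, kurims manuscript (May 2020), Example 3.2 (iii) p. 71: "the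
`p_v`-adic Frobenioid constituted by the 'base-field-theoretic hull' … `C_v ⊆ F̲_v` … may be reconstructed
category-theoretically from `F̲_v`"; Example 3.2 (vi) (d) p. 73: "the category `D_v` may be reconstructed
category-theoretically either from `F̲_v` [cf. [EtTh], Theorem 4.4; [EtTh], Proposition 5.1] or from `C_v` [cf. [FrdI],
Theorem 3.4, (v); [FrdII], Theorem 1.2, (i); [FrdII], Example 1.3, (i); [SemiAnbd], Example 3.10; [SemiAnbd], Remark
3.4.1]" [claim: Mochizuki2012, status: disputed] (D-0012 claim key, series status DISPUTED — this file is a PROOF-ONLY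
composition of landed theorems; nothing of the series is asserted; no side is taken on [IUTchIII] Cor. 3.12).
DAG nodes `IUTchI:Ex3.2(iii)` (kernel decl `BadLocalFrobenioid.CFromF`) and `IUTchI:Ex3.2(vi)` (`….DFromF` among
its decls), rows E32iii/L02 and E32vi/d of `plan/L5/SUBDAG-IUTchI-Ex32.md` (status before this file: "K at
`ofKits … R.toInput` modulo L1-t12's [EtTh] Cor 3.8 (ii) hypotheses … O at the genuine tempered Frobenioid" / "(γ)
schema; the `C_v` half would follow as in (c) once … Π^tp_v slim — after-merge").
S. Mochizuki, *The étale theta function …* [EtTh], Def. 3.6 (iv) p. 77 (the base-field-theoretic hull `C^{bs-fld}`),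
Cor. 3.8 (ii) p. 78 [cite: MochizukiEtTh2009, Cor 3.8 (ii) p.78]; *The geometry of Frobenioids I* [FrdI], Thm. 3.4 (v)
p. 58 [cite: MochizukiFrdI2008, Thm 3.4 (v) p.58]; [SemiAnbd] Example 3.10 p. 43 (slimness of `𝓑^temp(Π)⁰` for `Π`
tempered and slim) [cite: MochizukiSemiAnbd2006, Ex 3.10 p.43].

WHAT IS PROVED.  abc-iut-L5-t2 (gen 6) landed (iii) and (vi)(d) for the assembly `BadLocalFrobenioid.ofKits … R.toInput`
over an ARBITRARY Galois-valuation datum `d` and group datum `T` (`BadLocalFrobenioid.cFromF_ofKits_toInput`,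
`dFromF_ofKits_toInput_of_isTempered`, `BadLocalFrobenioidOfKitsTempered(Bases).lean`: `F̲_v := Fr.category` an
[EtTh] Def. 3.6 tempered Frobenioid `Fr` of abc-iut-L2-t3 over the REAL base `D_v = CosetCat Π_v`, `C_v := Fr^{bs-fld}`
its hull).  THIS FILE fires them at the GENUINE number-theoretic side (abc-iut-L5-t2 p442528 / p454048):
* `InitialThetaData.cFromF_badLocalFrobenioidAt_toInput` / `dFromF_badLocalFrobenioidAt_toInput_of_isTempered` — at
  `badLocalFrobenioidAt hv w p hw T R.toInput` (initial Θ-data `D`, `v̲ = w ∣ v ∈ V(F)^bad`, `K_v̲ = K_w`, genuine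
  `q_v̲`, `q̲_v̲`, `C⊢_v̲`), for EVERY input group datum `T` and EVERY [EtTh] tempered Frobenioid `Fr` on `D_v̲` with its
  remaining tempered-side input `R`, modulo the [EtTh] Cor. 3.8 (ii) hypothesis bundle on `Fr` (for (iii)) resp. the
  [FrdI] Thm. 3.4 (v) standard-hypothesis bundles + `Π_v̲` tempered and slim (for (vi)(d));
* `InitialThetaData.cFromF_badLocalFrobenioidAtDoubleUnderline_toInput` /
  `dFromF_badLocalFrobenioidAtDoubleUnderline_toInput` — the same AT THE [EtTh] §1 OBJECTS (`Π_v̲ := Π^tp_{X̲̲}` of the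
  double-underline curve), where "`Π_v̲` tempered and slim" are THEOREMS (`BadLocalGroupDatum.isTempered_Huu` of
  `BadLocalFrobenioidOfKitsDdash.lean`, `isSlimGroup_Huu` here, from abc-iut-L3's group-level bundle `dGL`), so (vi)(d) keeps ONLY the two [FrdI] Thm. 3.4 (v)
  bundles `hF`, `hC` displayed.
No new definition, instance or notation; every input BY NAME.  typed ≠ proved elsewhere; DISCHARGED here = proved as
typed under OUR kernel at these instances, modulo the hypotheses displayed in each signature; (iii)/(vi)(d) are schemas
(abc-iut-w4-d047's doubling model) — nothing is claimed off these instances; nothing asserts that a `ThetaSetting` or an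
[EtTh] tempered Frobenioid arises from an actual Tate curve.
-/

noncomputable section

namespace Literature.IUT.HodgeTheaters

open CategoryTheory Opposite Literature.AnabelianGeometry.SemiGraphs Literature.AlgebraicGeometry.Frobenioids
open Literature.AlgebraicGeometry.Frobenioids.PadicFrd Literature.AnabelianGeometry.EtaleTheta Topology

universe u₀ v₀

/-! ### §1 `Π^tp_{X̲̲}` of the double-underline curve is slim (abc-iut-L3's bundle by name; tempered: `isTempered_Huu`) -/

namespace BadLocalGroupDatum

variable {p : ℕ} [Fact p.Prime] {S : ThetaSetting p} {ES : S.EtaleThetaData} {l : ℕ}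

/-- **`Π^tp_{X̲̲}` is SLIM** (temp-slim) — an open subgroup of the slim `Π^tp_X` (abc-iut-L3's
`GroupLevelData.isSlimGroup` + `OneVertexCusps.isSlimGroup_of_isOpen`). [cite: MochizukiSemiAnbd2006, §0 p.6] -/
theorem isSlimGroup_Huu (dGL : S.toTemperedCurve.GroupLevelData) (C : ES.DoubleUnderline l) : IsSlimGroup ↥C.Huu :=
  OneVertexCusps.isSlimGroup_of_isOpen C.Huu dGL.isSlimGroup C.isOpen_Huu

end BadLocalGroupDatum

/-! ### §2 (iii) and (vi)(d) at the genuine datum `badLocalFrobenioidAt … R.toInput`, every input group datum -/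

section Datum

open NumberField IsDedekindDomain

variable {F K Fbar : Type} [Field F] [NumberField F] [Field K] [NumberField K] [Algebra F K]
  [Field Fbar] [Algebra F Fbar] [Algebra K Fbar] [IsScalarTower F K Fbar] {E : WeierstrassCurve F}
  [E.IsElliptic] {l : ℕ} {Pb : BadPlacePredicates K} (D : InitialThetaData F K Fbar E l Pb)
  {v : FinitePlace F} (hv : v ∈ D.VFbad) (w : HeightOneSpectrum (𝓞 K)) [w.asIdeal.LiesOver v.maximalIdeal.asIdeal]
  (p : ℕ) [Fact p.Prime] (hw : ((p : ℕ) : 𝓞 K) ∈ w.asIdeal)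
  {P : Type} [Group P] [TopologicalSpace P] [IsTopologicalGroup P]
  (T : BadLocalGroupDatum (GaloisValDatum.ofPlace K p w hw).Gal P)
  {D₀ : Type u₀} [Category.{v₀} D₀]

namespace InitialThetaData

/-- **[IUTchI] Ex. 3.2 (iii) AT THE GENUINE DATUM over an [EtTh] tempered Frobenioid**: for initial Θ-data `D` at
`v̲ = w ∣ v ∈ V(F)^bad` (`K_v̲ = K_w`, genuine `q_v̲`, `q̲_v̲`, `C⊢_v̲`), every input group datum `T` on `Π_v̲` and every
[EtTh] Def. 3.6 tempered Frobenioid `Fr` over `D_v̲ = CosetCat Π_v̲` (weak vocabulary) with remaining input `R`, "`C_v ⊆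
F̲_v` may be reconstructed category-theoretically from `F̲_v`" — `CFromF` — HOLDS at
`badLocalFrobenioidAt … R.toInput`, modulo abc-iut-L1-t12's [EtTh] Cor. 3.8 (ii) hypothesis bundle on `Fr` (`hnd`
non-dilating, `hds` Div-slim, `hF` Frobenioid, `h5` pre-step limit criterion, `hR` Rmk. 3.6.3) BY NAME through
abc-iut-L5-t2's `BadLocalFrobenioid.cFromF_ofKits_toInput`. ([IUTchI] Ex 3.2 (iii) p.71) [claim: Mochizuki2012, status: disputed] -/
theorem cFromF_badLocalFrobenioidAt_toInput
    {T' : RealifiedDivisorMonoids (D₀ := D₀) treeMonoidVocabWeak.{0}} {VD : FrdICatStub.{0, 0, 0} T.Dv}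
    (Fr : TemperedFrobenioid T' T.Dv VD) {Fbirat : Type} [Category.{0} Fbirat]
    (R : TemperedThetaRest (GaloisValDatum.ofPlace K p w hw) T (D.qRootAt_not_isUnit hv w p hw) Fr Fbirat)
    (hnd : ∀ (A : T.Dvᵒᵖ) (f : A ⟶ A), treeMonoidVocabWeak.{0}.IsNonDilating (Fr.Φ.carrier A) (Fr.Φ.pull f))
    (hds : ∀ (A : T.Dv) (α : Aut (Over.forget A)),
      (∀ (B : Over A) (x : Fr.divisorMonoid.obj (op B.left)),
        Literature.AlgebraicGeometry.Frobenioids.pull Fr.divisorMonoid (α.hom.app B) x = x) → α = 1)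
    (hF : PreFrobenioid.IsFrobenioid Fr.toElem)
    (h5 : Fr.BsFldPreStepLimitCriterion (PreFrobenioidData.perfection hF)) (hR : Fr.Remark363) :
    (D.badLocalFrobenioidAt hv w p hw T R.toInput).CFromF :=
  BadLocalFrobenioid.cFromF_ofKits_toInput l _ T _ _ _ _ Fr R hnd hds hF h5 hR

/-- **[IUTchI] Ex. 3.2 (vi) (d) AT THE GENUINE DATUM over an [EtTh] tempered Frobenioid**, both halves (`D_v̲` from
`F̲_v = Fr.category` and from `C_v = Fr^{bs-fld}`) — `DFromF` — HOLDS at `badLocalFrobenioidAt … R.toInput` for every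
input group datum on a TEMPERED SLIM `Π_v̲` ([SemiAnbd] Ex. 3.10, Rmk. 3.4.1: `𝓑^temp(Π_v̲)⁰` is slim), modulo the
[FrdI] Thm. 3.4 (v) standard-hypothesis bundles `hF`, `hC` for the self-equivalences of `F̲_v`, `C_v`, BY NAME through
abc-iut-L5-t2's `BadLocalFrobenioid.dFromF_ofKits_toInput_of_isTempered`.
([IUTchI] Ex 3.2 (vi) (d) p.73) [claim: Mochizuki2012, status: disputed] -/
theorem dFromF_badLocalFrobenioidAt_toInput_of_isTempered
    {V : FrdIMonoidStub.{0}} {T' : RealifiedDivisorMonoids (D₀ := D₀) V} {VD : FrdICatStub.{0, 0, 0} T.Dv}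
    (Fr : TemperedFrobenioid T' T.Dv VD) {Fbirat : Type} [Category.{0} Fbirat]
    (R : TemperedThetaRest (GaloisValDatum.ofPlace K p w hw) T (D.qRootAt_not_isUnit hv w p hw) Fr Fbirat)
    (hF : ∀ e : Fr.category ≌ Fr.category, FrdI.Thm34Sub.StdHyp Fr.toElem Fr.toElem e)
    (hC : ∀ e : Fr.hullCategory ≌ Fr.hullCategory,
      FrdI.Thm34Sub.StdHyp (ModelFrobenioid.toElem Fr.bsFldMonoid Fr.cnstFnBsFunctor Fr.divFNatTrans)
        (ModelFrobenioid.toElem Fr.bsFldMonoid Fr.cnstFnBsFunctor Fr.divFNatTrans) e)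
    (hG : IsTempered P) (hZ : IsSlimGroup P) :
    (D.badLocalFrobenioidAt hv w p hw T R.toInput).DFromF :=
  BadLocalFrobenioid.dFromF_ofKits_toInput_of_isTempered l _ T _ _ _ _ Fr R hF hC hG hZ

end InitialThetaData

end Datum

/-! ### §3 (iii) and (vi)(d) AT THE [EtTh] §1 OBJECTS: `Π_v̲ := Π^tp_{X̲̲}` of the double-underline curve -/

section DoubleUnderline

open NumberField IsDedekindDomain

variable {F K Fbar : Type} [Field F] [NumberField F] [Field K] [NumberField K] [Algebra F K]
  [Field Fbar] [Algebra F Fbar] [Algebra K Fbar] [IsScalarTower F K Fbar] {E : WeierstrassCurve F}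
  [E.IsElliptic] {l : ℕ} {Pb : BadPlacePredicates K} (D : InitialThetaData F K Fbar E l Pb)
  {v : FinitePlace F} (hv : v ∈ D.VFbad) (w : HeightOneSpectrum (𝓞 K)) [w.asIdeal.LiesOver v.maximalIdeal.asIdeal]
  (p : ℕ) [Fact p.Prime] (hw : ((p : ℕ) : 𝓞 K) ∈ w.asIdeal)
  {S : ThetaSetting p} {ES : S.EtaleThetaData} (dGL : S.toTemperedCurve.GroupLevelData) (hS2 : S.Sec2Hyps)
  (C : ES.DoubleUnderline l) (ι : ↥S.GK ≃ₜ* (GaloisValDatum.ofPlace K p w hw).Gal)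
  {D₀ : Type u₀} [Category.{v₀} D₀]

namespace InitialThetaData

/-- **[IUTchI] Ex. 3.2 (iii) AT THE GENUINE DATUM over the GENUINE group datum and an [EtTh] tempered Frobenioid**
(`badLocalFrobenioidAtDoubleUnderline … R.toInput`: `Π_v̲ := Π^tp_{X̲̲}`, `D_v̲ = CosetCat Π^tp_{X̲̲}`, `F̲_v := Fr.category`,
`C_v := Fr^{bs-fld}`): `CFromF` HOLDS modulo the [EtTh] Cor. 3.8 (ii) hypothesis bundle on `Fr` only.
([IUTchI] Ex 3.2 (iii) p.71) [claim: Mochizuki2012, status: disputed] -/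
theorem cFromF_badLocalFrobenioidAtDoubleUnderline_toInput
    {T' : RealifiedDivisorMonoids (D₀ := D₀) treeMonoidVocabWeak.{0}}
    {VD : FrdICatStub.{0, 0, 0} (badGroupDatumOfDoubleUnderline w p hw dGL hS2 C ι).Dv}
    (Fr : TemperedFrobenioid T' (badGroupDatumOfDoubleUnderline w p hw dGL hS2 C ι).Dv VD) {Fbirat : Type}
    [Category.{0} Fbirat]
    (R : TemperedThetaRest (GaloisValDatum.ofPlace K p w hw) (badGroupDatumOfDoubleUnderline w p hw dGL hS2 C ι)
      (D.qRootAt_not_isUnit hv w p hw) Fr Fbirat)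
    (hnd : ∀ (A : (badGroupDatumOfDoubleUnderline w p hw dGL hS2 C ι).Dvᵒᵖ) (f : A ⟶ A),
      treeMonoidVocabWeak.{0}.IsNonDilating (Fr.Φ.carrier A) (Fr.Φ.pull f))
    (hds : ∀ (A : (badGroupDatumOfDoubleUnderline w p hw dGL hS2 C ι).Dv) (α : Aut (Over.forget A)),
      (∀ (B : Over A) (x : Fr.divisorMonoid.obj (op B.left)),
        Literature.AlgebraicGeometry.Frobenioids.pull Fr.divisorMonoid (α.hom.app B) x = x) → α = 1)
    (hF : PreFrobenioid.IsFrobenioid Fr.toElem)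
    (h5 : Fr.BsFldPreStepLimitCriterion (PreFrobenioidData.perfection hF)) (hR : Fr.Remark363) :
    (D.badLocalFrobenioidAtDoubleUnderline hv w p hw dGL hS2 C ι R.toInput).CFromF :=
  D.cFromF_badLocalFrobenioidAt_toInput hv w p hw _ Fr R hnd hds hF h5 hR

/-- **[IUTchI] Ex. 3.2 (vi) (d) AT THE GENUINE DATUM over the GENUINE group datum and an [EtTh] tempered Frobenioid**,
both halves: temperedness and slimness of `Π_v̲ = Π^tp_{X̲̲}` are THEOREMS here (abc-iut-L3's bundle `dGL`), so `DFromF`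
HOLDS modulo ONLY the two [FrdI] Thm. 3.4 (v) standard-hypothesis bundles `hF`, `hC` for the self-equivalences of
`F̲_v = Fr.category` and `C_v = Fr^{bs-fld}`. ([IUTchI] Ex 3.2 (vi) (d) p.73) [claim: Mochizuki2012, status: disputed] -/
theorem dFromF_badLocalFrobenioidAtDoubleUnderline_toInput
    {V : FrdIMonoidStub.{0}} {T' : RealifiedDivisorMonoids (D₀ := D₀) V}
    {VD : FrdICatStub.{0, 0, 0} (badGroupDatumOfDoubleUnderline w p hw dGL hS2 C ι).Dv}
    (Fr : TemperedFrobenioid T' (badGroupDatumOfDoubleUnderline w p hw dGL hS2 C ι).Dv VD) {Fbirat : Type}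
    [Category.{0} Fbirat]
    (R : TemperedThetaRest (GaloisValDatum.ofPlace K p w hw) (badGroupDatumOfDoubleUnderline w p hw dGL hS2 C ι)
      (D.qRootAt_not_isUnit hv w p hw) Fr Fbirat)
    (hF : ∀ e : Fr.category ≌ Fr.category, FrdI.Thm34Sub.StdHyp Fr.toElem Fr.toElem e)
    (hC : ∀ e : Fr.hullCategory ≌ Fr.hullCategory,
      FrdI.Thm34Sub.StdHyp (ModelFrobenioid.toElem Fr.bsFldMonoid Fr.cnstFnBsFunctor Fr.divFNatTrans)
        (ModelFrobenioid.toElem Fr.bsFldMonoid Fr.cnstFnBsFunctor Fr.divFNatTrans) e) :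
    (D.badLocalFrobenioidAtDoubleUnderline hv w p hw dGL hS2 C ι R.toInput).DFromF :=
  D.dFromF_badLocalFrobenioidAt_toInput_of_isTempered hv w p hw _ Fr R hF hC
    (BadLocalGroupDatum.isTempered_Huu dGL C) (BadLocalGroupDatum.isSlimGroup_Huu dGL C)

end InitialThetaData

end DoubleUnderline

end Literature.IUT.HodgeTheaters

end
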